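import Summits.FinalStateConjecture.FinalStateConjecture.Theorems.SwallowTheDatumKerrShieldedDataExistCapFarKilling
import Summits.FinalStateConjecture.FinalStateConjecture.Theorems.SwallowTheDatumKerrShieldedDataExistCapFarShift
import Summits.FinalStateConjecture.FinalStateConjecture.Theorems.SwallowTheDatumKerrShieldedDataExistCapFarSymbolK
import Literature.Geometry.Lorentzian.InducedVacuumData
import HarnessLib

/-!
# `KerrShieldedDataExist`, line `plug-the-second-sheet` (skeleton v4 "KerrCap") — stub `stub_capFarK`:
# the far zone of the cap is a Dafermos–Rodnianski end, second-fundamental-form half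

Support file (`--supports stmt-FinalStateConjecture-10055`; everything proved, no definitions, no named facts):
the registered stub `stub_capFarK` of `Cruxes/KerrShieldedDataExist/Lines/plug_the_second_sheet.lean`, proved
verbatim. On the far zone `s = ‖u‖ > σ₅` the cap map `Ψ(u) = (T(q s) + c, X u)` IS the Boyer–Lindquist slice
`{t_BL = c}` of Kerr(`M, a`) in quasi-isotropic Cartesian coordinates, and the stationary Killing vector
`∂_{t*} = ∂_{t_BL}` splits along it as `∂_t = N_l ν + DΨ(b)` (lapse `N_l = 1/m`, shift `b = β ẑ × u`,
`β = −2Mar s²/A_s`; `…CapFarShift.lean`). Hence, whatever future unit normal `N` is given (it equals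
`m(∂_{t*} − DΨ b)` there, `KerrCap.capFar_normal_eq`), the second fundamental form is

  `K_N(v, w) = −(m/2) (𝓛_b h)(v, w) = −(m/2)(∂_b[h(v, w)] + h(Db v, w) + h(v, Db w))`

(`KerrCap.secondFundamentalForm_capFar`: the chart-generic Killing identity `KerrCap.secondFundamentalForm_add_swap_eq`
of `…CapFarKilling.lean`, symmetry of `K`, stationarity `Kerr.fderiv_bilin_basisVector_zero`, and the closed form of
`h` from `…StubCapFarH.lean`) — the classical `K_{ij} = (2N)⁻¹(∇_iβ_j + ∇_jβ_i)` of a stationary slicing. With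
`b ∈ O(s⁻²)`, `Db ∈ O(s⁻³)`, `Dh ∈ O(s⁻¹)`, `m, h ∈ O(1)` as smooth symbols (`…CapFarSymbolK.lean`) this is
`O_k(s⁻³)` for every `k`; in particular any total field `kTot` agreeing with `K_N` beyond `σ₅` lies in `O₁(s⁻³)`
(**`stub_capFarK`**), the Dafermos–Rodnianski admissibility of `k` on the end (only the `rφ`, `θφ`
Boyer–Lindquist components are nonzero, of orders `aM/r²`, `a³M/r³`: Brandt–Seidel 1996).

References: Wald 1984, (10.2.13), (E.2.30); Brandt–Seidel, PRD 54 (1996) 1403, §II; Bartnik, CPAM 39 (1986),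
Def. 2.1; Dafermos–Rodnianski arXiv:0811.0354, App. B.2.3; O'Neill 1983, Ch. 4, Lemma 4.4.
-/

-- the doubled `FinalStateConjecture` path component is the summit/problem naming scheme, not a mistake
set_option linter.dupNamespace false
-- iterated operator-norm spaces (values of `DG`, `D²Φ`): nested instance problems, as in `CoordTensorCovariance.lean`
set_option maxSynthPendingDepth 3

noncomputable section

open Set Function Filter Topology TopologicalSpace Bornology
open scoped Manifold ContDiff Topology InnerProductSpace
open Literature.Geometry.Lorentzian
open Summit.FinalStateConjecture.FinalStateConjecture.Theorems.KerrShieldedDataExist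

namespace Summit.FinalStateConjecture.FinalStateConjecture.Theorems.SwallowTheDatum

namespace KerrCap

section Far

variable {M a c σ₅ : ℝ} {τ ϱ α : ℝ → ℝ} {X : E3 → E3}

/-- **The second fundamental form of the cap on the far zone is `−(m/2) 𝓛_b h`**: for `u ∈ Ω` with `‖u‖ > σ₅`,
any smooth future unit normal field `N` along `Ψ`, and `b`, `m` the shift and inverse lapse of
`capFar_lapseShift` (differentiable at `u`),
`K_N(v, w) = −(m(u)/2)(∂_{b(u)}[h(v, w)] + h_u(Db(u)v, w) + h_u(v, Db(u)w))` with the CLOSED FORM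
`h_z(v, w) = (Σ_s/s⁴)⟪v, w⟫ + a²(r²s² + 2Mrs² + a²z₂²)/(Σ_s s⁴)(z₀v₁ − z₁v₀)(z₀w₁ − z₁w₀)` of the induced
metric (`bilin_fderiv_capFar`): `K_N` is symmetric (`secondFundamentalForm_comm`), `N = m(∂_{t*} − DΦ b)` near `u`
(`capFar_normal_eq`), `∂_{t*}` is Killing (`Kerr.fderiv_bilin_basisVector_zero`), and
`secondFundamentalForm_add_swap_eq` applies. This is `K_{ij} = (2N)⁻¹(∇_iβ_j + ∇_jβ_i)` for the
Boyer–Lindquist slicing of Kerr (Wald 1984, (10.2.13), (E.2.30); Brandt–Seidel 1996, §II).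
[cite: Wald1984, (10.2.13)] [cite: BrandtSeidel1996, §II] -/
theorem secondFundamentalForm_capFar [Kerr.Facts] {σ rc : ℝ} {Ω : Opens E3} {Ψ : Ω → Kerr.region a rc}
    {N : E3 → E4} (hMn : 0 ≤ M) (ha : |a| < M) (hσ : 0 < σ) (hσ₅ : σ < σ₅)
    (hτ : ContDiff ℝ ∞ τ) (hϱ : ContDiff ℝ ∞ ϱ) (hα : ContDiff ℝ ∞ α)
    (hfar : ∀ s, σ₅ ≤ s → τ s = Negative.bentHeight M a (ϱ s) + c ∧
      ϱ s = s + M + (M ^ 2 - a ^ 2) / (4 * s) ∧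
      α s = a / (Kerr.rPlus M a - Kerr.rMinus M a) *
        Real.log ((ϱ s - Kerr.rPlus M a) / (ϱ s - Kerr.rMinus M a)))
    (h8 : ∀ s, σ₅ ≤ s → 8 * M < ϱ s)
    (hX : ∀ u : E3, X u =
      !₂[(ϱ ‖u‖ * (Real.cos (α ‖u‖) * u 0 - Real.sin (α ‖u‖) * u 1) -
            a * (Real.sin (α ‖u‖) * u 0 + Real.cos (α ‖u‖) * u 1)) / ‖u‖,
         (ϱ ‖u‖ * (Real.sin (α ‖u‖) * u 0 + Real.cos (α ‖u‖) * u 1) +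
            a * (Real.cos (α ‖u‖) * u 0 - Real.sin (α ‖u‖) * u 1)) / ‖u‖,
         ϱ ‖u‖ * u 2 / ‖u‖])
    {b : E3 → E3} {m : E3 → ℝ}
    (hb : ∀ u : E3, b u = (-(2 * M * ϱ ‖u‖ * a * ‖u‖ ^ 2 /
        ((ϱ ‖u‖ ^ 2 + a ^ 2) ^ 2 * ‖u‖ ^ 2 -
          (ϱ ‖u‖ ^ 2 - 2 * M * ϱ ‖u‖ + a ^ 2) * a ^ 2 * (‖u‖ ^ 2 - u 2 ^ 2)))) • !₂[-u 1, u 0, 0])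
    (hm : ∀ u : E3, m u = Real.sqrt (((ϱ ‖u‖ ^ 2 + a ^ 2) ^ 2 * ‖u‖ ^ 2 -
          (ϱ ‖u‖ ^ 2 - 2 * M * ϱ ‖u‖ + a ^ 2) * a ^ 2 * (‖u‖ ^ 2 - u 2 ^ 2)) /
        ((ϱ ‖u‖ ^ 2 * ‖u‖ ^ 2 + a ^ 2 * u 2 ^ 2) * (ϱ ‖u‖ ^ 2 - 2 * M * ϱ ‖u‖ + a ^ 2))))
    (hΩ : (Ω : Set E3) = {u : E3 | σ < ‖u‖})
    (hΨ : ∀ u : Ω, (Ψ u : E4) = E4.ofTimeSpace (τ ‖(u : E3)‖) (X u))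
    (hN : (Kerr.smoothMetric M a rc).IsFutureUnitNormal 𝓘(ℝ, E3)
      ((Kerr.timeOrientation M a rc hMn).ofLE le_top) Ψ (fun u ↦ N u))
    (hNs : ContDiffOn ℝ ∞ N Ω) [(Kerr.smoothMetric M a rc).HasLeviCivita]
    (u : Ω) (hu : σ₅ < ‖(u : E3)‖) (hmd : DifferentiableAt ℝ m u) (hbd : DifferentiableAt ℝ b u)
    (v w : E3) :
    (Kerr.smoothMetric M a rc).secondFundamentalForm 𝓘(ℝ, E3) Ψ (fun u ↦ N u) u v w =
      -(m u / 2 * (fderiv ℝ (fun z : E3 ↦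
          (ϱ ‖z‖ ^ 2 * ‖z‖ ^ 2 + a ^ 2 * z 2 ^ 2) / ‖z‖ ^ 4 * ⟪v, w⟫_ℝ +
            a ^ 2 * (ϱ ‖z‖ ^ 2 * ‖z‖ ^ 2 + 2 * M * ϱ ‖z‖ * ‖z‖ ^ 2 + a ^ 2 * z 2 ^ 2) /
              ((ϱ ‖z‖ ^ 2 * ‖z‖ ^ 2 + a ^ 2 * z 2 ^ 2) * ‖z‖ ^ 4) *
            ((z 0 * v 1 - z 1 * v 0) * (z 0 * w 1 - z 1 * w 0))) u (b u) +
        ((ϱ ‖(u : E3)‖ ^ 2 * ‖(u : E3)‖ ^ 2 + a ^ 2 * (u : E3) 2 ^ 2) / ‖(u : E3)‖ ^ 4 *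
            ⟪fderiv ℝ b u v, w⟫_ℝ +
          a ^ 2 * (ϱ ‖(u : E3)‖ ^ 2 * ‖(u : E3)‖ ^ 2 + 2 * M * ϱ ‖(u : E3)‖ * ‖(u : E3)‖ ^ 2 +
                a ^ 2 * (u : E3) 2 ^ 2) /
              ((ϱ ‖(u : E3)‖ ^ 2 * ‖(u : E3)‖ ^ 2 + a ^ 2 * (u : E3) 2 ^ 2) * ‖(u : E3)‖ ^ 4) *
            (((u : E3) 0 * fderiv ℝ b u v 1 - (u : E3) 1 * fderiv ℝ b u v 0) *
              ((u : E3) 0 * w 1 - (u : E3) 1 * w 0))) +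
        ((ϱ ‖(u : E3)‖ ^ 2 * ‖(u : E3)‖ ^ 2 + a ^ 2 * (u : E3) 2 ^ 2) / ‖(u : E3)‖ ^ 4 *
            ⟪v, fderiv ℝ b u w⟫_ℝ +
          a ^ 2 * (ϱ ‖(u : E3)‖ ^ 2 * ‖(u : E3)‖ ^ 2 + 2 * M * ϱ ‖(u : E3)‖ * ‖(u : E3)‖ ^ 2 +
                a ^ 2 * (u : E3) 2 ^ 2) /
              ((ϱ ‖(u : E3)‖ ^ 2 * ‖(u : E3)‖ ^ 2 + a ^ 2 * (u : E3) 2 ^ 2) * ‖(u : E3)‖ ^ 4) *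
            (((u : E3) 0 * v 1 - (u : E3) 1 * v 0) *
              ((u : E3) 0 * fderiv ℝ b u w 1 - (u : E3) 1 * fderiv ℝ b u w 0))))) := by
  have hσ₅0 : 0 < σ₅ := hσ.trans hσ₅
  have hs0 : 0 < ‖(u : E3)‖ := hσ₅0.trans hu
  have hu0 : (u : E3) ≠ 0 := norm_ne_zero_iff.1 hs0.ne'
  have hM := Negative.mass_pos ha
  have hr0 : 0 < ϱ ‖(u : E3)‖ := by linarith [h8 ‖(u : E3)‖ hu.le]
  have hne : ∀ z : Ω, (z : E3) ≠ 0 := by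
    intro z h0
    have hz : (z : E3) ∈ (Ω : Set E3) := z.2
    rw [hΩ, Set.mem_setOf_eq, h0, norm_zero] at hz
    exact lt_irrefl 0 (hσ.trans hz)
  set Φ : E3 → E4 := fun u ↦ E4.ofTimeSpace (τ ‖u‖) (X u) with hΦdef
  have hΦΨ : ∀ z : Ω, (Ψ z : E4) = Φ z := hΨ
  -- smoothness of `Ψ` and of the lift of `N`
  have hΨs : ContMDiff 𝓘(ℝ, E3) 𝓘(ℝ, E4) ∞ Ψ := fun z ↦
    (ChartedSpace.liftPropWithinAt_subtypeVal_comp_iff Ψ Set.univ z).mp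
      ((OpensChart.contMDiffAt_iff z (Subtype.val ∘ Ψ) Φ (fun z ↦ hΨ z)).2
        (contDiffAt_capImm hX hτ hϱ hα (hne z)))
  have hlift := OpensChart.contMDiff_lift_of_contDiffOn hΨs (ν := fun u ↦ N u) (N := N) (fun _ ↦ rfl) hNs
  -- symmetry of `K`
  have hsymm := (Kerr.smoothMetric M a rc).toPseudoRiemannianMetric.secondFundamentalForm_comm
    (I' := 𝓘(ℝ, E3)) (f := Ψ) (ν := fun u ↦ N u) hΨs hN.1.1 hlift u v w
  -- the Killing identity
  have hrad : 0 < Kerr.radius a (Φ u) := by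
    show 0 < Kerr.radius a (E4.ofTimeSpace (τ ‖(u : E3)‖) (X u))
    rw [radius_capMap hX hu0 hr0]; exact hr0
  have hGd : DifferentiableAt ℝ (Kerr.bilin M a) (Φ u) :=
    (Kerr.contDiffAt_bilin M a hrad (n := 1)).differentiableAt one_ne_zero
  have hT : fderiv ℝ (Kerr.bilin M a) (Φ u) (E4.basisVector 0) = 0 := Kerr.fderiv_bilin_basisVector_zero M a hGd
  have hΦ2 : ContDiffAt ℝ 2 Φ u := (contDiffAt_capImm hX hτ hϱ hα hu0).of_le (by norm_cast)
  have hNev : N =ᶠ[𝓝 (u : E3)] fun z ↦ m z • (E4.basisVector 0 - fderiv ℝ Φ z (b z)) := by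
    filter_upwards [(isOpen_lt continuous_const continuous_norm).mem_nhds hu] with z hz
    have hzΩ : z ∈ (Ω : Set E3) := by rw [hΩ]; exact hσ₅.trans hz
    exact capFar_normal_eq hMn ha hσ₅0 hτ hϱ hα hfar h8 hX hb hm hΨ hN ⟨z, hzΩ⟩ hz
  obtain ⟨hnormal, -, -⟩ := capFar_lapseShift ha hσ₅0 hτ hϱ hα hfar h8 hX hb hm hu
  have key := secondFundamentalForm_add_swap_eq (g := (Kerr.smoothMetric M a rc).toPseudoRiemannianMetric)
    (G := Kerr.bilin M a) (Kerr.smoothMetric_val M a rc) (Kerr.bilin_symm M a) (f := Ψ) (Φ := Φ) hΦΨ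
    (ν := fun u ↦ N u) (N := N) (fun _ ↦ rfl) (y := u) (T := E4.basisVector 0) hΦ2 hmd hbd hNev hGd hT
    hnormal v w
  -- the closed form of `h`, near `u` and at `u`
  have hcf := fun (z : E3) (hz : σ₅ < ‖z‖) (v' w' : E3) ↦
    bilin_fderiv_capFar ha hσ₅0 hτ hϱ hα hfar h8 hX hz (τ ‖z‖) v' w'
  have hev : (fun z : E3 ↦ Kerr.bilin M a (Φ z) (fderiv ℝ Φ z v) (fderiv ℝ Φ z w)) =ᶠ[𝓝 (u : E3)]
      fun z : E3 ↦ (ϱ ‖z‖ ^ 2 * ‖z‖ ^ 2 + a ^ 2 * z 2 ^ 2) / ‖z‖ ^ 4 * ⟪v, w⟫_ℝ +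
        a ^ 2 * (ϱ ‖z‖ ^ 2 * ‖z‖ ^ 2 + 2 * M * ϱ ‖z‖ * ‖z‖ ^ 2 + a ^ 2 * z 2 ^ 2) /
          ((ϱ ‖z‖ ^ 2 * ‖z‖ ^ 2 + a ^ 2 * z 2 ^ 2) * ‖z‖ ^ 4) *
        ((z 0 * v 1 - z 1 * v 0) * (z 0 * w 1 - z 1 * w 0)) := by
    filter_upwards [(isOpen_lt continuous_const continuous_norm).mem_nhds hu] with z hz
    exact hcf z hz v w
  rw [hev.fderiv_eq, hcf (u : E3) hu, hcf (u : E3) hu] at key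
  rw [← hsymm] at key
  linear_combination key / 2

end Far

end KerrCap

/-! ### The stub -/

/-- **Stub `stub_capFarK` of the line `plug-the-second-sheet` (v4 "KerrCap"), proved verbatim** (asymptotics of
the second fundamental form): on the far zone the cap map is the Boyer–Lindquist slice `{t_BL = const}` of
Kerr(`M, a`) in quasi-isotropic Cartesian coordinates; whatever smooth future unit normal `N` is given, its second
fundamental form is `K_N = −(m/2) 𝓛_b h` there (`KerrCap.secondFundamentalForm_capFar`: lapse–shift splitting of
the Killing vector `∂_{t*}`, uniqueness of the future unit normal, the Killing identity in the chart), an `O_k(s⁻³)`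
smooth symbol for every `k` (`KerrCap.isBigOSmooth_capFarK`: `b ∈ O(s⁻²)`, `Db ∈ O(s⁻³)`, `Dh ∈ O(s⁻¹)`,
`m, h ∈ O(1)`); so any total field `kTot` agreeing with it beyond `σ₅` lies in `O₁(s⁻³)` — componentwise on the
standard basis (`IsBigOSmooth.of_bilinForm_apply`) it agrees far out with that symbol (`IsBigOSmooth.congr_far`;
far enough that the explicit `m`, `b` are smooth there). [cite: BrandtSeidel1996, §II] [cite: Wald1984, (10.2.13)]
[cite: Bartnik1986, Def. 2.1] -/
theorem stub_capFarK :
    ∀ [Kerr.Facts] (M a c σ σ₅ rc : ℝ) (hM : 0 ≤ M) (τ ϱ α : ℝ → ℝ) (X : E3 → E3) (Ω : Opens E3)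
      (Ψ : Ω → Kerr.region a rc) (N : E3 → E4) (kTot : E3 → E3 →L[ℝ] E3 →L[ℝ] ℝ),
      |a| < M → 0 ≤ rc → 0 < σ → σ < σ₅ →
      ContDiff ℝ ∞ τ → ContDiff ℝ ∞ ϱ → ContDiff ℝ ∞ α →
      (∀ s, σ₅ ≤ s → τ s = Negative.bentHeight M a (ϱ s) + c ∧
        ϱ s = s + M + (M ^ 2 - a ^ 2) / (4 * s) ∧
        α s = a / (Kerr.rPlus M a - Kerr.rMinus M a) *
          Real.log ((ϱ s - Kerr.rPlus M a) / (ϱ s - Kerr.rMinus M a))) →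
      (∀ s, σ₅ ≤ s → 8 * M < ϱ s) →
      (∀ u : E3, X u =
        !₂[(ϱ ‖u‖ * (Real.cos (α ‖u‖) * u 0 - Real.sin (α ‖u‖) * u 1) -
              a * (Real.sin (α ‖u‖) * u 0 + Real.cos (α ‖u‖) * u 1)) / ‖u‖,
           (ϱ ‖u‖ * (Real.sin (α ‖u‖) * u 0 + Real.cos (α ‖u‖) * u 1) +
              a * (Real.cos (α ‖u‖) * u 0 - Real.sin (α ‖u‖) * u 1)) / ‖u‖,
           ϱ ‖u‖ * u 2 / ‖u‖]) →
      (Ω : Set E3) = {u : E3 | σ < ‖u‖} →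
      (∀ u : Ω, (Ψ u : E4) = E4.ofTimeSpace (τ ‖(u : E3)‖) (X u)) →
      (Kerr.smoothMetric M a rc).IsFutureUnitNormal 𝓘(ℝ, E3)
        ((Kerr.timeOrientation M a rc hM).ofLE le_top) Ψ (fun u ↦ N u) → ContDiffOn ℝ ∞ N Ω →
      (∀ [(Kerr.smoothMetric M a rc).HasLeviCivita] (u : Ω), σ₅ < ‖(u : E3)‖ → ∀ v w : E3,
        kTot (u : E3) v w = (Kerr.smoothMetric M a rc).secondFundamentalForm 𝓘(ℝ, E3) Ψ (fun u ↦ N u) u v w) →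
      IsBigOSmooth 1 (-3) kTot := by
  intro inst M a c σ σ₅ rc hM τ ϱ α X Ω Ψ N kTot ha _hrc hσ hσ₅ hτ hϱ hα hfar h8 hX hΩ hΨ hN hNs hK
  have hσ₅0 : 0 < σ₅ := hσ.trans hσ₅
  have hfar' : ∀ s, σ₅ ≤ s → ϱ s = s + M + (M ^ 2 - a ^ 2) / (4 * s) := fun s hs ↦ (hfar s hs).2.1
  haveI hLC : (Kerr.smoothMetric M a rc).HasLeviCivita :=
    (Kerr.smoothMetric M a rc).toPseudoRiemannianMetric.hasLeviCivita
  -- the shift field and the inverse lapse of the Boyer–Lindquist slicing, as explicit functions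
  set b : E3 → E3 := fun u ↦ (-(2 * M * ϱ ‖u‖ * a * ‖u‖ ^ 2 /
      ((ϱ ‖u‖ ^ 2 + a ^ 2) ^ 2 * ‖u‖ ^ 2 -
        (ϱ ‖u‖ ^ 2 - 2 * M * ϱ ‖u‖ + a ^ 2) * a ^ 2 * (‖u‖ ^ 2 - u 2 ^ 2)))) • !₂[-u 1, u 0, 0] with hbdef
  set m : E3 → ℝ := fun u ↦ Real.sqrt (((ϱ ‖u‖ ^ 2 + a ^ 2) ^ 2 * ‖u‖ ^ 2 -
        (ϱ ‖u‖ ^ 2 - 2 * M * ϱ ‖u‖ + a ^ 2) * a ^ 2 * (‖u‖ ^ 2 - u 2 ^ 2)) /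
      ((ϱ ‖u‖ ^ 2 * ‖u‖ ^ 2 + a ^ 2 * u 2 ^ 2) * (ϱ ‖u‖ ^ 2 - 2 * M * ϱ ‖u‖ + a ^ 2))) with hmdef
  have hb : ∀ u : E3, b u = (-(2 * M * ϱ ‖u‖ * a * ‖u‖ ^ 2 /
      ((ϱ ‖u‖ ^ 2 + a ^ 2) ^ 2 * ‖u‖ ^ 2 -
        (ϱ ‖u‖ ^ 2 - 2 * M * ϱ ‖u‖ + a ^ 2) * a ^ 2 * (‖u‖ ^ 2 - u 2 ^ 2)))) • !₂[-u 1, u 0, 0] :=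
    fun u ↦ rfl
  have hm : ∀ u : E3, m u = Real.sqrt (((ϱ ‖u‖ ^ 2 + a ^ 2) ^ 2 * ‖u‖ ^ 2 -
        (ϱ ‖u‖ ^ 2 - 2 * M * ϱ ‖u‖ + a ^ 2) * a ^ 2 * (‖u‖ ^ 2 - u 2 ^ 2)) /
      ((ϱ ‖u‖ ^ 2 * ‖u‖ ^ 2 + a ^ 2 * u 2 ^ 2) * (ϱ ‖u‖ ^ 2 - 2 * M * ϱ ‖u‖ + a ^ 2))) := fun u ↦ rfl
  -- far out `b` and `m` are smooth
  obtain ⟨Rb, hRb⟩ := (KerrCap.isBigOSmooth_far_shift hσ₅0 hfar' 1 hb).eventually_contDiffAt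
  obtain ⟨Rm, hRm⟩ := (KerrCap.isBigOSmooth_far_invLapse hσ₅0 hfar' 1 hm).eventually_contDiffAt
  refine IsBigOSmooth.of_bilinForm_apply (EuclideanSpace.basisFun (Fin 3) ℝ) fun i j ↦ ?_
  refine (KerrCap.isBigOSmooth_capFarK hσ₅0 hfar' 1 hb hm (EuclideanSpace.basisFun (Fin 3) ℝ i)
    (EuclideanSpace.basisFun (Fin 3) ℝ j)).congr_far (R₁ := max σ₅ (max Rb Rm)) fun y hy ↦ ?_
  have hyσ : σ₅ < ‖y‖ := lt_of_le_of_lt (le_max_left _ _) hy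
  have hyb : Rb < ‖y‖ := lt_of_le_of_lt ((le_max_left _ _).trans (le_max_right _ _)) hy
  have hym : Rm < ‖y‖ := lt_of_le_of_lt ((le_max_right _ _).trans (le_max_right _ _)) hy
  have hyΩ : y ∈ (Ω : Set E3) := by
    rw [hΩ]
    exact hσ₅.trans hyσ
  have hmd : DifferentiableAt ℝ m y := (hRm y hym).differentiableAt (by simp)
  have hbd : DifferentiableAt ℝ b y := (hRb y hyb).differentiableAt (by simp)
  rw [hK ⟨y, hyΩ⟩ hyσ, KerrCap.secondFundamentalForm_capFar hM ha hσ hσ₅ hτ hϱ hα hfar h8 hX hb hm hΩ hΨ hN hNs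
    ⟨y, hyΩ⟩ hyσ hmd hbd]

end Summit.FinalStateConjecture.FinalStateConjecture.Theorems.SwallowTheDatum

end
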